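import Literature.NumberTheory.PAdicHodge.AinfRamifiedEtaPeriod
import Literature.NumberTheory.PAdicHodge.AinfRamifiedPeriodsBounded
import HarnessLib

/-!
# Boundedness of the η-period over the ramified base: `k!·∫_t η ∈ ι_𝒪(A_inf(𝒪)) + Fil^k B_dR⁺` (proofs only)

Topic `Literature/NumberTheory/PAdicHodge`; namespace `Literature.NumberTheory.PAdicHodge.AinfRamTop`. THEOREMS ONLY (no definition,
no named fact, no instance, no `sorry`). The η-analogue of `AinfRamTop.omegaPeriod_bounded` (file `AinfRamifiedPeriodsBounded`, §4) for
the η-period of `AinfRamifiedEtaPeriod` (`∫_t η = η₀(ι_𝒪T₀) − ι_𝒪(corr t)`, `W` over `𝒪_D`): the denominators of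
`η₀ = ∫(xω − dz/z²)` are those of `∫`, i.e. `(n+1)·η₀_{n+1} = gₙ ∈ 𝒪_D` (`g = formalQuasiPeriodIntegrand`, an integral series), so
`k!·η₀(ι_𝒪T₀) ∈ ι_𝒪(A_inf(𝒪)) + Fil^k` by `BdRPlusTop.exists_eq_toBdR_add_of_coeff`, and the correction is already in `ι_𝒪(A_inf(𝒪))`:

* `succ_mul_coeff_succ_etaSeries` (`(n+1)·η₀_{n+1} = gₙ`), `exists_algebraMap_factorial_mul_coeff_etaSeries_eq`;
* **`etaPeriodMain_bounded`**, **`etaPeriod_bounded`**: `k!·∫_t η = ι_𝒪(b) + ξ_dR^k·w`, uniformly in the `[p]`-compatible sequence `t`.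

With `AinfRam.map_smul_eq_of_bounded` this gives the `ℤ_p`-linearity of `τ ↦ ∫_τ η` on `T_pŴ(𝒪_{ℂ_F})` (road item (E0′) of the de Rham
socket for the additive cells of crux K★ `stmt-BirchSwinnertonDyer-22226`, BSD route EdixhovenFibreFiveSeven). BSD / K★ are not proved here.

## References
* P. Colmez, *Périodes p-adiques des variétés abéliennes*, Math. Ann. 292 (1992), §2. [Colmez1992PeriodesAbeliennes]
* J.-M. Fontaine, *Le corps des périodes p-adiques*, Astérisque 223 (1994), Exp. II §1.5.3. [FontaineAsterisque223III]
* N. M. Katz, *Crystalline cohomology, Dieudonné modules, and Jacobi sums* (1981), §5.1. [Katz1981CrystallineDieudonne]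
-/

noncomputable section

open Ideal Filter Topology Field WittVector MvPowerSeries ValuativeRel

namespace Literature.NumberTheory.PAdicHodge

open Literature.NumberTheory.GaloisRepresentations
open Literature.NumberTheory.GaloisRepresentations.IsNonarchimedeanLocalField
open Literature.NumberTheory.GaloisRepresentations.LubinTate

namespace AinfRamTop

variable {F : Type} [Field F] [ValuativeRel F] [TopologicalSpace F] [IsNonarchimedeanLocalField F] [CharZero F]
  {p : ℕ} [Fact p.Prime] [Fact (¬ IsUnit (p : integerC F))] [IsAdicComplete (Ideal.span {(p : integerC F)}) (integerC F)]
  {hp : valuation F p < 1} {D : EisensteinRoot F p hp} {hθ : Function.Surjective (fontaineTheta (integerC F) p)}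
  (W : WeierstrassCurve (EisensteinRoot.CoeffDisc D))

/-- **`(n+1)·coeff (n+1) η₀ = gₙ ∈ 𝒪_D`** for `W` over `𝒪_D` (`η₀ = ∫ g`, `g = formalQuasiPeriodIntegrand` integral).
[cite: Katz1981CrystallineDieudonne, §5.1] -/
theorem succ_mul_coeff_succ_etaSeries (n : ℕ) :
    ((n : FieldCoeff hp hθ) + 1) * PowerSeries.coeff (n + 1) (etaSeries hθ W) =
      FieldCoeff.of hp hθ (EisensteinRoot.CoeffDisc.toF D (PowerSeries.coeff n W.formalQuasiPeriodIntegrand)) := by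
  rw [etaSeries, WeierstrassCurve.coeff_succ_formalQuasiPeriod, ← WeierstrassCurve.map_formalQuasiPeriodIntegrand,
    PowerSeries.coeff_map, ← mul_assoc]
  have h1 : ((n : FieldCoeff hp hθ) + 1) * algebraMap ℚ (FieldCoeff hp hθ) (1 / (n + 1 : ℚ)) = 1 := by
    rw [map_div₀, map_one, map_add, map_natCast, map_one, mul_one_div_cancel (Nat.cast_add_one_ne_zero n)]
  rw [h1, one_mul]
  rfl

/-- From `(n+1)·f_{n+1} ∈ 𝒪_D` to `k!·fₙ ∈ 𝒪_D` for `n ≤ k`. [folklore] -/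
private theorem exists_factorial_mul_coeff_eq' (f : PowerSeries (FieldCoeff hp hθ)) (hf0 : PowerSeries.constantCoeff f = 0)
    (c : ℕ → EisensteinRoot.CoeffDisc D)
    (hf : ∀ n : ℕ, ((n : FieldCoeff hp hθ) + 1) * PowerSeries.coeff (n + 1) f =
      FieldCoeff.of hp hθ (EisensteinRoot.CoeffDisc.toF D (c n))) (k n : ℕ) (hn : n < k + 1) :
    ∃ z : EisensteinRoot.CoeffDisc D, ((k.factorial : ℤ) : FieldCoeff hp hθ) * PowerSeries.coeff n f =
      FieldCoeff.of hp hθ (EisensteinRoot.CoeffDisc.toF D z) := by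
  rcases n with _ | m
  · exact ⟨0, by rw [PowerSeries.coeff_zero_eq_constantCoeff, hf0, mul_zero, map_zero, map_zero]⟩
  · have hdvd : m + 1 ∣ k.factorial := Nat.dvd_factorial (Nat.succ_pos m) (by omega)
    obtain ⟨q, hq⟩ := hdvd
    refine ⟨(q : EisensteinRoot.CoeffDisc D) * c m, ?_⟩
    rw [hq, Nat.cast_mul, Int.cast_mul, Int.cast_natCast, Int.cast_natCast, map_mul, map_natCast, map_mul, map_natCast, ← hf m,
      Nat.cast_succ]
    ring

/-- `k!·η₀ₙ ∈ ι_𝒪(A_inf(𝒪))` read in `B_dR⁺` (`n ≤ k`): the coefficient `(k!/n)·g_{n-1} ∈ 𝒪_D` maps through `𝒪_D → A_inf(𝒪) → B_dR⁺`,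
which agrees with `𝒪_D → F → B_dR⁺` (`AinfRam.toBdR_coeffHom`). [cite: FontaineAsterisque223III, Exp. II §1.5.3] -/
theorem exists_algebraMap_factorial_mul_coeff_etaSeries_eq (k n : ℕ) (hn : n < k + 1) :
    ∃ b : AinfRam D, algebraMap (FieldCoeff hp hθ) (BdRPlusTop F p)
        (((k.factorial : ℤ) : FieldCoeff hp hθ) * PowerSeries.coeff n (etaSeries hθ W)) =
      BdRPlusTop.of F p (AinfRam.toBdR D hθ b) := by
  obtain ⟨z, hz⟩ := exists_factorial_mul_coeff_eq' (etaSeries hθ W) (constantCoeff_etaSeries W) _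
    (succ_mul_coeff_succ_etaSeries W) k n hn
  refine ⟨AinfRam.coeffHom D ((EisensteinRoot.CoeffDisc.of D).symm z), ?_⟩
  rw [hz, FieldCoeff.algebraMap_of, AinfRam.toBdR_coeffHom]
  rfl

/-- **`k!·η₀(ι_𝒪[t]) ∈ ι_𝒪(A_inf(𝒪)) + Fil^k B_dR⁺`**, uniformly in `t`. [cite: Colmez1992PeriodesAbeliennes, §2] -/
theorem etaPeriodMain_bounded (k : ℕ) {t : ℕ → (maxNilIdealC F).toIdeal} (ht0 : (t 0 : CBall F) = 0)
    (htp : ∀ n, mulPC W (t (n + 1)) = t n) :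
    ∃ (b : AinfRam D) (w : BdRPlusTop F p),
      ((k.factorial : ℤ) : BdRPlusTop F p) * etaPeriodMain W hθ t ht0 htp =
        BdRPlusTop.of F p (AinfRam.toBdR D hθ b) + BdRPlusTop.of F p xiBdR ^ k * w :=
  BdRPlusTop.exists_eq_toBdR_add_of_coeff D (etaSeries hθ W) (constantCoeff_etaSeries W) k _
    (fun n hn => exists_algebraMap_factorial_mul_coeff_etaSeries_eq W k n (by omega))
    (toBdR_torsionLift_mem_filOne W ht0 htp)

/-- **`k!·∫_t η ∈ ι_𝒪(A_inf(𝒪)) + Fil^k B_dR⁺`**, uniformly in `t` (`∫_t η = η₀(ι_𝒪[t]) − ι_𝒪(corr t)` and `ι_𝒪(corr t) ∈ ι_𝒪(A_inf(𝒪))`).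
[cite: Colmez1992PeriodesAbeliennes, §2] -/
theorem etaPeriod_bounded (k : ℕ) {t : ℕ → (maxNilIdealC F).toIdeal} (ht0 : (t 0 : CBall F) = 0)
    (htp : ∀ n, mulPC W (t (n + 1)) = t n) :
    ∃ (b : AinfRam D) (w : BdRPlusTop F p),
      ((k.factorial : ℤ) : BdRPlusTop F p) * etaPeriod W hθ t ht0 htp =
        BdRPlusTop.of F p (AinfRam.toBdR D hθ b) + BdRPlusTop.of F p xiBdR ^ k * w := by
  obtain ⟨b, w, h⟩ := etaPeriodMain_bounded W (hθ := hθ) k ht0 htp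
  refine ⟨b - (k.factorial : ℤ) * (of D).symm (etaCorr W hθ t htp), w, ?_⟩
  rw [etaPeriod, mul_sub, h, map_sub, map_mul, map_intCast, map_sub, map_mul, map_intCast]
  ring

end AinfRamTop

end Literature.NumberTheory.PAdicHodge

end
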